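import Literature.AlgebraicGeometry.Frobenioids.BiratUnitsConjugation
import HarnessLib

/-!
# Frobenioids I, Prop. 4.4 (ii) (2024 form) / Thm. 5.2 (iv): the rational function monoid of a Frobenioid
# of isotropic and model type EXISTS — Thm. 5.2 (iv) is non-vacuous

Mochizuki, *The geometry of Frobenioids I: the general theory*, Kyushu J. Math. **62** (2008)
293–400, §4 Prop. 4.4 (ii) p. 83 with the author's *Comments* (2024) item (29)(i) ("the rational function
monoid of the Frobenioid `C`" = the functor `O^×(−)` on `D` associated to `C^birat`, Prop. 2.2 (ii),(iii)),
§5 Thm. 5.2 (iv) p. 101 [cite: MochizukiFrdI2008, Thm. 5.2 (iv) p.101].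

Row W15 `Thm52ivRationalFunctionMonoidExists` (L1-lead R89 (6)), disposition of GAP-LEDGER G-w4d020-1
(seat abc-iut-w4-d020): abc-iut-L6-t8's `Thm52iv F hF hsq` (discharged, `thm52iv_holds`) quantifies over
monoids `B` on `D` carrying `RationalFunctionMonoidStr F hF B DivB` ("`B` is the rational function monoid
of `C`"), a structure inhabited in the tree only for model Frobenioids; here it is INHABITED for EVERY
Frobenioid of isotropic and model type. Construction (DEFINITIONS, review lane): `BiratUnits.conj g`
(transport of `O^×(A^birat)` along an isomorphism `g` of `C^birat`, `u ↦ g⁻¹ u g`; its properties are the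
proof-only piece `BiratUnitsConjugation.lean`); `IsBaseSection.sec/secIso/secMap` (the object `P_X` of a
base-section `P ⥲ D` over `X` and the pull-back `P_f` over `f`, Def. 2.7 (i) — model type supplies `P`);
**`rationalFunctionMonoid`: `X ↦ O^×((P_X)^birat)`, `f ↦` abc-iut-L6-t8's `transportHom` along `P_f`**,
valued in commutative monoids since birational Frobenius-normalization makes `O^×(A^birat)` abelian;
`rationalFunctionDiv` (`Div_B = (Base P_X ≅ X)⁻¹^* ∘ Div`); `rationalFunctionMonoidStr` (`iso A = conjEquiv`
along a chosen isomorphism `(P_{Base A})^birat ⥲ A^birat` over the counit — choice-free by base-only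
dependence; `div_iso` by `divHom_conj`; `natural` by `intertwines_conj_transportHom`: the pull-back
property of `P_f^birat`, Prop. 4.4 (iv), reduces naturality along any linear `ψ` to commutation with a
unit). RESULTS: `rationalFunctionMonoid_exists` (Prop. 4.4 (ii), 2024 form) and `thm52iv_nonvacuous` —
**every Frobenioid of isotropic and model type is equivalent, compatibly with the structure functors, to a
model Frobenioid** (Thm. 5.2 (iv) instantiated). UNIVERSE NOTE: `RationalFunctionMonoidStr` pins `B` to
`Φ`'s universe while `O^×(A^birat)` lives in `max u' v'`; everything is stated with `C`, its morphisms and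
the values of `Φ` in ONE universe (all concrete cases). No statement of the paper is strengthened;
nothing here bears on the disputed parts of [IUTchIII].
-/

namespace Literature.AlgebraicGeometry.Frobenioids

open CategoryTheory Opposite

namespace PreFrobenioid

universe v u u'

variable {D : Type u} [Category.{v} D] {Φ : Dᵒᵖ ⥤ CommMonCat.{u'}}
  {C : Type u'} [Category.{u'} C] {F : C ⥤ ElemFrobenioid Φ}

namespace BiratUnits

variable {hF : IsFrobenioid F} {hsq : HasBiratSquares F} {A A' A'' : C}

variable (hsq) in
/-- **Transport of units along an isomorphism `g : A^birat ⥲ A'^birat` of `C^birat`**: `u ↦ g⁻¹ u g`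
(the functor `O^×(−)` of Prop. 2.2 (ii) on the isomorphisms of `C^birat`, read on abc-iut-L6-t8's
`BiratUnits`). [cite: MochizukiFrdI2008, Prop. 2.2 (ii) p.45] -/
noncomputable def conj (g : (toBirat F hF hsq).obj A ≅ (toBirat F hF hsq).obj A') :
    BiratUnits F hF A →* BiratUnits F hF A' where
  toFun x := (exists_toHom_eq_conj g x).choose
  map_one' := by
    apply toHom_injective (hsq := hsq)
    rw [(exists_toHom_eq_conj g 1).choose_spec, toHom_one, toHom_one, Category.id_comp, g.inv_hom_id]
  map_mul' x₁ x₂ := by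
    apply toHom_injective (hsq := hsq)
    rw [(exists_toHom_eq_conj g (x₁ * x₂)).choose_spec, toHom_mul, toHom_mul,
      (exists_toHom_eq_conj g x₁).choose_spec, (exists_toHom_eq_conj g x₂).choose_spec]
    simp only [Category.assoc, g.hom_inv_id_assoc]

/-- The defining equation of `conj`: `toHom (conj g x) = g⁻¹ ≫ toHom x ≫ g`.
[cite: MochizukiFrdI2008, Prop. 2.2 (ii) p.45] -/
theorem toHom_conj (g : (toBirat F hF hsq).obj A ≅ (toBirat F hF hsq).obj A') (x : BiratUnits F hF A) :
    toHom hsq (conj hsq g x) = g.inv ≫ toHom hsq x ≫ g.hom :=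
  (exists_toHom_eq_conj g x).choose_spec

/-- `conj` is characterised by its defining equation. [cite: MochizukiFrdI2008, Prop. 2.2 (ii) p.45] -/
theorem eq_conj_of_toHom_eq {g : (toBirat F hF hsq).obj A ≅ (toBirat F hF hsq).obj A'}
    {x : BiratUnits F hF A} {y : BiratUnits F hF A'} (h : toHom hsq y = g.inv ≫ toHom hsq x ≫ g.hom) :
    y = conj hsq g x :=
  toHom_injective (hsq := hsq) (h.trans (toHom_conj g x).symm)

/-- `conj` along the identity is the identity. [cite: MochizukiFrdI2008, Prop. 2.2 (ii) p.45] -/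
theorem conj_refl (x : BiratUnits F hF A) : conj hsq (Iso.refl ((toBirat F hF hsq).obj A)) x = x := by
  symm; apply eq_conj_of_toHom_eq
  simp only [Iso.refl_inv, Iso.refl_hom, Category.id_comp, Category.comp_id]

/-- `conj` is compatible with composition of isomorphisms. [cite: MochizukiFrdI2008, Prop. 2.2 (ii) p.45] -/
theorem conj_trans (g : (toBirat F hF hsq).obj A ≅ (toBirat F hF hsq).obj A')
    (g' : (toBirat F hF hsq).obj A' ≅ (toBirat F hF hsq).obj A'') (x : BiratUnits F hF A) :
    conj hsq (g ≪≫ g') x = conj hsq g' (conj hsq g x) := by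
  symm; apply eq_conj_of_toHom_eq
  rw [toHom_conj, toHom_conj]
  simp only [Iso.trans_inv, Iso.trans_hom, Category.assoc]

/-- `conj g⁻¹ ∘ conj g = id`. [cite: MochizukiFrdI2008, Prop. 2.2 (ii) p.45] -/
theorem conj_symm_conj (g : (toBirat F hF hsq).obj A ≅ (toBirat F hF hsq).obj A') (x : BiratUnits F hF A) :
    conj hsq g.symm (conj hsq g x) = x := by
  rw [← conj_trans, Iso.self_symm_id, conj_refl]

/-- `conj g ∘ conj g⁻¹ = id`. [cite: MochizukiFrdI2008, Prop. 2.2 (ii) p.45] -/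
theorem conj_conj_symm (g : (toBirat F hF hsq).obj A ≅ (toBirat F hF hsq).obj A') (y : BiratUnits F hF A') :
    conj hsq g (conj hsq g.symm y) = y := by
  rw [← conj_trans, Iso.symm_self_id, conj_refl]

variable (hsq) in
/-- `conj` along `g` as a group isomorphism `O^×(A^birat) ≃ O^×(A'^birat)`.
[cite: MochizukiFrdI2008, Prop. 2.2 (ii) p.45] -/
noncomputable def conjEquiv (g : (toBirat F hF hsq).obj A ≅ (toBirat F hF hsq).obj A') :
    BiratUnits F hF A ≃* BiratUnits F hF A' :=
  MulEquiv.ofBijective (conj hsq g)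
    ⟨fun x₁ x₂ h => by simpa only [conj_symm_conj] using congrArg (conj hsq g.symm) h,
      fun y => ⟨conj hsq g.symm y, conj_conj_symm g y⟩⟩

/-- **Transport depends only on the base map** (for a birationally Frobenius-normalized target):
`BiratUnitsConjugation.eq_of_toHom_eq_conj_of_gpBase_eq`. [cite: MochizukiFrdI2008, Prop. 2.2 (ii) p.46] -/
theorem conj_eq_of_gpBase_eq (hA' : IsBiratFrobeniusNormalized F hF hsq A')
    (g₁ g₂ : (toBirat F hF hsq).obj A ≅ (toBirat F hF hsq).obj A')
    (h : Birat.gpBase g₁.hom = Birat.gpBase g₂.hom) (x : BiratUnits F hF A) :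
    conj hsq g₁ x = conj hsq g₂ x :=
  eq_of_toHom_eq_conj_of_gpBase_eq hA' h (toHom_conj g₁ x) (toHom_conj g₂ x)

/-- `Div(conj g x) = Base(g⁻¹)^* Div(x)`. [cite: MochizukiFrdI2008, Prop. 4.4 (i) p.83] -/
theorem divHom_conj (g : (toBirat F hF hsq).obj A ≅ (toBirat F hF hsq).obj A') (x : BiratUnits F hF A) :
    divHom hF A' (conj hsq g x) = pullGp Φ (Birat.gpBase g.inv) (divHom hF A x) :=
  divHom_eq_of_toHom_eq_conj (toHom_conj g x)

/-- On the isomorphism of a co-angular pre-step, `conj` is abc-iut-L6-t8's `push`.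
[cite: MochizukiFrdI2008, Prop. 2.2 (ii) p.45] -/
theorem conj_asIso_eq_push (ψ : A ⟶ A') (hψ : IsCoAngularPreStep F ψ) (x : BiratUnits F hF A) :
    haveI := Birat.isIso_toBirat_map (hF := hF) (hsq := hsq) ψ hψ
    conj hsq (asIso ((toBirat F hF hsq).map ψ)) x = push hF ψ hψ x := by
  haveI := Birat.isIso_toBirat_map (hF := hF) (hsq := hsq) ψ hψ
  symm; apply eq_conj_of_toHom_eq
  rw [asIso_inv, asIso_hom]
  exact toHom_push_eq ψ hψ x

end BiratUnits

/-! ### Chosen objects over the base: a base-section `P ⥲ D` -/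

namespace IsBaseSection

variable {P : Presection C} (hP : IsBaseSection F P)

/-- The equivalence `P ⥲ D` of Def. 2.7 (i)(c). [cite: MochizukiFrdI2008, Def. 2.7 (i) p.51] -/
noncomputable def equiv : P.Cat ≌ D := @Functor.asEquivalence _ _ _ _ (P.toBase F) hP.isEquivalence

/-- The object of `P` over `X ∈ Ob(D)` (quasi-inverse of `P ⥲ D`). [cite: MochizukiFrdI2008, Def. 2.7 (i) p.51] -/
noncomputable def sec (X : D) : C := P.ι.obj (hP.equiv.inverse.obj X)

/-- `Base(P_X) ≅ X` (counit of `P ⥲ D`). [cite: MochizukiFrdI2008, Def. 2.7 (i) p.51] -/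
noncomputable def secIso (X : D) : baseObj F (hP.sec X) ≅ X := hP.equiv.counitIso.app X

/-- The `P`-arrow over `f : X → Y` between the chosen objects. [cite: MochizukiFrdI2008, Def. 2.7 (i) p.51] -/
noncomputable def secMap {X Y : D} (f : X ⟶ Y) : hP.sec X ⟶ hP.sec Y :=
  P.ι.map (hP.equiv.inverse.map f)

/-- `P_f` lies in `P`, hence is a pull-back morphism. [cite: MochizukiFrdI2008, Def. 2.7 (i) p.51] -/
theorem isPullbackMorphism_secMap {X Y : D} (f : X ⟶ Y) : IsPullbackMorphism F (hP.secMap f) :=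
  hP.hom_pullback _ (hP.equiv.inverse.map f).2

/-- `P_f` is linear (pull-back morphisms are linear, Def. 1.3 (iv)(b)).
[cite: MochizukiFrdI2008, Def. 1.3 (iv) p.25] -/
theorem isLinear_secMap (hF : IsFrobenioid F) {X Y : D} (f : X ⟶ Y) : IsLinear F (hP.secMap f) :=
  (hF.iv_b _ (hP.isPullbackMorphism_secMap f)).2

/-- `secMap` respects identities. [cite: MochizukiFrdI2008, Def. 2.7 (i) p.51] -/
theorem secMap_id (X : D) : hP.secMap (𝟙 X) = 𝟙 (hP.sec X) := by
  unfold secMap; rw [hP.equiv.inverse.map_id]; rfl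

/-- `secMap` respects composition. [cite: MochizukiFrdI2008, Def. 2.7 (i) p.51] -/
theorem secMap_comp {X Y Z : D} (f : X ⟶ Y) (g : Y ⟶ Z) :
    hP.secMap (f ≫ g) = hP.secMap f ≫ hP.secMap g := by
  unfold secMap; rw [hP.equiv.inverse.map_comp]; rfl

/-- `Base(P_f) ≫ (Base P_Y ≅ Y) = (Base P_X ≅ X) ≫ f` (naturality of the counit).
[cite: MochizukiFrdI2008, Def. 2.7 (i) p.51] -/
theorem base_secMap {X Y : D} (f : X ⟶ Y) :
    Base F (hP.secMap f) ≫ (hP.secIso Y).hom = (hP.secIso X).hom ≫ f :=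
  hP.equiv.counitIso.hom.naturality f

/-- The same with the inverse isomorphisms. [cite: MochizukiFrdI2008, Def. 2.7 (i) p.51] -/
theorem inv_secIso_comp_base_secMap {X Y : D} (f : X ⟶ Y) :
    (hP.secIso X).inv ≫ Base F (hP.secMap f) = f ≫ (hP.secIso Y).inv := by
  rw [Iso.inv_comp_eq, ← Category.assoc, ← hP.base_secMap f, Category.assoc, Iso.hom_inv_id,
    Category.comp_id]

end IsBaseSection

namespace BiratUnits

variable {hF : IsFrobenioid F} {hsq : HasBiratSquares F}

/-- `O^×(A^birat)` as a commutative monoid, for `A` birationally Frobenius-normalized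
(`mul_comm_of_isBiratFrobeniusNormalized`). [cite: MochizukiFrdI2008, Def. 4.5 (i) p.86] -/
@[reducible] noncomputable def commMonoid {A : C} (hA : IsBiratFrobeniusNormalized F hF hsq A) :
    CommMonoid (BiratUnits F hF A) :=
  { (inferInstance : Monoid (BiratUnits F hF A)) with
    mul_comm := mul_comm_of_isBiratFrobeniusNormalized hA }

end BiratUnits

/-! ### The rational function monoid `B` of a Frobenioid of isotropic and model type -/

section RationalFunctionMonoid

variable (hF : IsFrobenioid F) (hsq : HasBiratSquares F) (hiso : IsOfIsotropicType F)
  {P : Presection C} (hP : IsBaseSection F P) (hbfn : ∀ A : C, IsBiratFrobeniusNormalized F hF hsq A)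

/-- **The rational function monoid** `B : Dᵒᵖ ⥤ CommMon` of a Frobenioid of isotropic type with a
base-section `P` and birationally Frobenius-normalized objects ([FrdI] Prop. 4.4 (ii), 2024 form: "the
functor `O^×(−)` on `D` associated to the Frobenioid `C^birat`"): `X ↦ O^×((P_X)^birat)` for the object
`P_X` of `P` over `X`, `f ↦` the transport of units along the pull-back morphism `P_f` (Prop. 2.2 (ii)(a),
abc-iut-L6-t8's `BiratUnits.transportHom`). [cite: MochizukiFrdI2008, Prop. 4.4 (ii) p.83] -/
noncomputable def rationalFunctionMonoid : Dᵒᵖ ⥤ CommMonCat.{u'} where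
  obj X := @CommMonCat.of (BiratUnits F hF (hP.sec X.unop)) (BiratUnits.commMonoid (hbfn _))
  map {X Y} f := @CommMonCat.ofHom (BiratUnits F hF (hP.sec X.unop)) (BiratUnits F hF (hP.sec Y.unop))
    (BiratUnits.commMonoid (hbfn _)) (BiratUnits.commMonoid (hbfn _))
    (BiratUnits.transportHom hF hsq hiso (hP.secMap f.unop) (hP.isLinear_secMap hF f.unop))
  map_id X := by
    apply CommMonCat.hom_ext
    refine MonoidHom.ext fun v => ?_
    change BiratUnits.transportHom hF hsq hiso (hP.secMap (𝟙 X.unop))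
      (hP.isLinear_secMap hF (𝟙 X.unop)) v = v
    rw [BiratUnits.transportHom_congr hiso (hP.secMap_id X.unop) _ (isLinear_of_isIso F _) v]
    exact BiratUnits.transportHom_id hiso _ v
  map_comp {X Y Z} f g := by
    apply CommMonCat.hom_ext
    refine MonoidHom.ext fun v => ?_
    change BiratUnits.transportHom hF hsq hiso (hP.secMap (g.unop ≫ f.unop))
        (hP.isLinear_secMap hF (g.unop ≫ f.unop)) v =
      BiratUnits.transportHom hF hsq hiso (hP.secMap g.unop) (hP.isLinear_secMap hF g.unop)
        (BiratUnits.transportHom hF hsq hiso (hP.secMap f.unop) (hP.isLinear_secMap hF f.unop) v)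
    rw [BiratUnits.transportHom_congr hiso (hP.secMap_comp g.unop f.unop) _
      (IsLinear.comp F (hP.isLinear_secMap hF g.unop) (hP.isLinear_secMap hF f.unop)) v]
    exact BiratUnits.transportHom_comp hiso _ _ _ _ v

/-- `B(f)` is the transport of units along `P_f`. [cite: MochizukiFrdI2008, Prop. 2.2 (ii) p.45] -/
theorem rationalFunctionMonoid_map_apply {X Y : Dᵒᵖ} (f : X ⟶ Y)
    (v : BiratUnits F hF (hP.sec X.unop)) :
    ((rationalFunctionMonoid hF hsq hiso hP hbfn).map f).hom v =
      BiratUnits.transportHom hF hsq hiso (hP.secMap f.unop) (hP.isLinear_secMap hF f.unop) v :=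
  rfl

/-- **`Div_B : B → Φ^gp`**, the natural homomorphism `O^×(−) → Φ^gp` of Prop. 4.4 (iii): at `X`, the
divisor map of `O^×((P_X)^birat)` followed by `Φ^gp(Base P_X) ≅ Φ^gp(X)`.
[cite: MochizukiFrdI2008, Prop. 4.4 (iii) p.83] -/
noncomputable def rationalFunctionDiv : rationalFunctionMonoid hF hsq hiso hP hbfn ⟶ monoidGp Φ where
  app X := @CommMonCat.ofHom (BiratUnits F hF (hP.sec X.unop)) _ (BiratUnits.commMonoid (hbfn _)) _
    ((pullGp Φ (hP.secIso X.unop).inv).comp (BiratUnits.divHom hF (hP.sec X.unop)))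
  naturality {X Y} f := by
    apply CommMonCat.hom_ext
    refine MonoidHom.ext fun v => ?_
    change pullGp Φ (hP.secIso Y.unop).inv (BiratUnits.divHom hF (hP.sec Y.unop)
        (BiratUnits.transportHom hF hsq hiso (hP.secMap f.unop) (hP.isLinear_secMap hF f.unop) v)) =
      pullGp Φ f.unop (pullGp Φ (hP.secIso X.unop).inv (BiratUnits.divHom hF (hP.sec X.unop) v))
    rw [BiratUnits.divHom_transportHom, ← pullGp_comp, ← pullGp_comp,
      hP.inv_secIso_comp_base_secMap f.unop]

/-- `Div_B` at `X` is `(Base P_X ≅ X)⁻¹^* ∘ Div` on `O^×((P_X)^birat)`.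
[cite: MochizukiFrdI2008, Prop. 4.4 (iii) p.83] -/
theorem rationalFunctionDiv_app_apply (X : Dᵒᵖ) (v : BiratUnits F hF (hP.sec X.unop)) :
    ((rationalFunctionDiv hF hsq hiso hP hbfn).app X).hom v =
      pullGp Φ (hP.secIso X.unop).inv (BiratUnits.divHom hF (hP.sec X.unop) v) :=
  rfl

/-- A chosen isomorphism `(P_{Base A})^birat ⥲ A^birat` of `C^birat` over the counit `Base P_{Base A} ≅
Base A`. [cite: MochizukiFrdI2008, Prop. 2.2 (ii) p.46] -/
noncomputable def secBiratIso (A : C) :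
    (toBirat F hF hsq).obj (hP.sec (baseObj F A)) ≅ (toBirat F hF hsq).obj A :=
  (Birat.exists_iso_of_baseIso (hF := hF) (hsq := hsq) hiso _ A (hP.secIso (baseObj F A))).choose

/-- Its base map is the counit. [cite: MochizukiFrdI2008, Prop. 2.2 (ii) p.46] -/
theorem gpBase_secBiratIso_hom (A : C) :
    Birat.gpBase (secBiratIso hF hsq hiso hP A).hom = (hP.secIso (baseObj F A)).hom :=
  (Birat.exists_iso_of_baseIso (hF := hF) (hsq := hsq) hiso _ A (hP.secIso (baseObj F A))).choose_spec

/-- … and the base map of its inverse is the inverse of the counit. [cite: MochizukiFrdI2008, Prop. 2.2 (ii) p.46] -/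
theorem gpBase_secBiratIso_inv (A : C) :
    Birat.gpBase (secBiratIso hF hsq hiso hP A).inv = (hP.secIso (baseObj F A)).inv :=
  ((hP.secIso (baseObj F A)).comp_hom_eq_id).mp
    (by rw [← gpBase_secBiratIso_hom hF hsq hiso hP A]; exact BiratUnits.gpBase_inv_comp_hom _)

include hbfn in
/-- The key naturality: for a linear `ψ : A → A′` and `b′ ∈ O^×((P_{Base A′})^birat)`, the unit of
`A^birat` obtained by transporting `b′` along the pull-back `P_{Base ψ}` and then conjugating into
`A^birat` INTERTWINES along `ψ` with the conjugate of `b′` into `A′^birat`. Proof: the composite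
`m := g_A ≫ ψ^birat ≫ g_{A′}⁻¹ : (P_{Base A})^birat → (P_{Base A′})^birat` has the base map of the
pull-back `μ := P_{Base ψ}`, so by the pull-back property of `μ^birat` (Prop. 4.4 (iv)) `m = k ≫ μ^birat`
with `k` a base-identity linear endomorphism, i.e. a unit `y₀` of `(P_{Base A})^birat`; units commute
(birational Frobenius-normalization), so the transport relation along `μ^birat` passes to `m`.
[cite: MochizukiFrdI2008, Prop. 2.2 (ii) p.46] -/
theorem intertwines_conj_transportHom {A A' : C} (ψ : A ⟶ A') (hψ : IsLinear F ψ)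
    (b' : BiratUnits F hF (hP.sec (baseObj F A'))) :
    BiratUnits.Intertwines hF ψ
      (BiratUnits.conj hsq (secBiratIso hF hsq hiso hP A)
        (BiratUnits.transportHom hF hsq hiso (hP.secMap (Base F ψ)) (hP.isLinear_secMap hF (Base F ψ)) b'))
      (BiratUnits.conj hsq (secBiratIso hF hsq hiso hP A') b') := by
  have hμlin := hP.isLinear_secMap hF (Base F ψ)
  -- the transport relation along `μ^birat`
  have hT := (BiratUnits.intertwines_iff_toHom_comm hsq _ _ _).mp
    (BiratUnits.intertwines_transportHom (hF := hF) (hsq := hsq) hiso (hP.secMap (Base F ψ)) hμlin b')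
  rw [BiratUnits.intertwines_iff_toHom_comm hsq, BiratUnits.toHom_conj, BiratUnits.toHom_conj]
  -- names
  generalize hg : secBiratIso hF hsq hiso hP A = g at *
  generalize hg' : secBiratIso hF hsq hiso hP A' = g' at *
  generalize ht : BiratUnits.transportHom hF hsq hiso (hP.secMap (Base F ψ)) hμlin b' = t at *
  have hgb : Birat.gpBase g.hom = (hP.secIso (baseObj F A)).hom := by
    rw [← hg]; exact gpBase_secBiratIso_hom hF hsq hiso hP A
  have hg'b : Birat.gpBase g'.inv = (hP.secIso (baseObj F A')).inv := by
    rw [← hg']; exact gpBase_secBiratIso_inv hF hsq hiso hP A'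
  -- the base of `m := g ≫ ψ^birat ≫ g'⁻¹` is `Base μ`
  have hbase : Birat.gpBase (g.hom ≫ (toBirat F hF hsq).map ψ ≫ g'.inv) =
      𝟙 _ ≫ Birat.gpBase ((toBirat F hF hsq).map (hP.secMap (Base F ψ))) := by
    rw [Birat.gpBase_comp, Birat.gpBase_comp, hgb, Birat.gpBase_map, hg'b, Category.id_comp,
      Birat.gpBase_map]
    have e := ((Iso.eq_comp_inv _).mpr (hP.base_secMap (Base F ψ))).symm
    simpa only [Category.assoc] using e
  -- pull-back property of `μ^birat`: `m = k ≫ μ^birat` with `Base k = id`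
  obtain ⟨k, hk⟩ := (Birat.isPullbackMorphism_toBirat_map (hF := hF) (hsq := hsq)
    (hP.isPullbackMorphism_secMap (Base F ψ)) ((toBirat F hF hsq).obj (hP.sec (baseObj F A)))).2
    ⟨(g.hom ≫ (toBirat F hF hsq).map ψ ≫ g'.inv, 𝟙 _), hbase⟩
  have hk₁ : k ≫ (toBirat F hF hsq).map (hP.secMap (Base F ψ)) = g.hom ≫ (toBirat F hF hsq).map ψ ≫ g'.inv :=
    congrArg (fun p => p.1.1) hk
  have hk₂ : Birat.gpBase k = 𝟙 _ := congrArg (fun p => p.1.2) hk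
  -- `k` is linear, hence a unit `y₀`
  have hkdeg : Birat.gpDeg k = 1 := by
    have h := congrArg Birat.gpDeg hk₁
    rw [Birat.gpDeg_comp, Birat.gpDeg_comp, Birat.gpDeg_comp, Birat.gpDeg_map, Birat.gpDeg_map,
      show degFr F (hP.secMap (Base F ψ)) = 1 from hμlin, show degFr F ψ = 1 from hψ,
      (BiratUnits.gpDeg_iso_hom g).1, (BiratUnits.gpDeg_iso_hom g').2, mul_one, mul_one, mul_one] at h
    exact h
  obtain ⟨y₀, hy₀⟩ := BiratUnits.exists_toHom_eq_of_isBaseIdentity_isLinear (hF := hF) (hsq := hsq) k hk₂ hkdeg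
  -- units of `(P_{Base A})^birat` commute
  have hcomm : t * y₀ = y₀ * t := BiratUnits.mul_comm_of_isBiratFrobeniusNormalized (hbfn _) t y₀
  -- `toHom t ≫ m = m ≫ toHom b'`
  have E : BiratUnits.toHom hsq t ≫ (g.hom ≫ (toBirat F hF hsq).map ψ ≫ g'.inv) =
      (g.hom ≫ (toBirat F hF hsq).map ψ ≫ g'.inv) ≫ BiratUnits.toHom hsq b' := by
    rw [← hk₁, ← hy₀, ← Category.assoc, ← BiratUnits.toHom_mul, ← hcomm, BiratUnits.toHom_mul,
      Category.assoc, hT, Category.assoc]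
  -- conjugate back
  have E' := congrArg (fun z => g.inv ≫ z ≫ g'.hom) E
  simp only [Category.assoc, Iso.inv_hom_id, Category.comp_id, Iso.inv_hom_id_assoc] at E'
  simpa only [Category.assoc] using E'

/-- **`B` IS the rational function monoid of `C`** (the hypothesis structure of Thm. 5.2 (iv),
`RationalFunctionMonoidStr`): `O^×((P_{Base A})^birat) ≅ O^×(A^birat)` by conjugation along a chosen
isomorphism of `C^birat` over the counit (independent of the choice, `conj_eq_of_gpBase_eq`), compatible
with the divisor maps, and natural along linear morphisms (`intertwines_conj_transportHom`).
[cite: MochizukiFrdI2008, Thm. 5.2 (iv) p.101] -/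
noncomputable def rationalFunctionMonoidStr :
    RationalFunctionMonoidStr F hF (rationalFunctionMonoid hF hsq hiso hP hbfn)
      (rationalFunctionDiv hF hsq hiso hP hbfn) where
  iso A := BiratUnits.conjEquiv hsq (secBiratIso hF hsq hiso hP A)
  div_iso A b := by
    change BiratUnits.divHom hF A (BiratUnits.conj hsq (secBiratIso hF hsq hiso hP A) b) =
      pullGp Φ (hP.secIso (baseObj F A)).inv (BiratUnits.divHom hF (hP.sec (baseObj F A)) b)
    rw [BiratUnits.divHom_conj, gpBase_secBiratIso_inv hF hsq hiso hP]
  natural {A A'} ψ hψ b' := intertwines_conj_transportHom hF hsq hiso hP hbfn ψ hψ b'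

end RationalFunctionMonoid

/-- **[FrdI] Prop. 4.4 (ii) (2024 form) — the rational function monoid EXISTS**: for a Frobenioid
`C → F_Φ` of isotropic and model type there is a monoid `B` on `D` with `Div_B : B → Φ^gp` which IS the
rational function monoid of `C` in the sense of `RationalFunctionMonoidStr` (the hypothesis structure of
`Thm52iv`). Universe note: `B` is pinned to `Φ`'s universe by `RationalFunctionMonoidStr`, while
`O^×(A^birat)` lives in `max u' v'`; the statement is for `C`, its morphisms and `Φ` in one universe.
[cite: MochizukiFrdI2008, Prop. 4.4 (ii) p.83] -/
theorem rationalFunctionMonoid_exists (hF : IsFrobenioid F) (hsq : HasBiratSquares F)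
    (hiso : IsOfIsotropicType F) (hm : IsOfModelType F hF hsq) :
    ∃ (B : Dᵒᵖ ⥤ CommMonCat.{u'}) (DivB : B ⟶ monoidGp Φ),
      Nonempty (RationalFunctionMonoidStr F hF B DivB) := by
  obtain ⟨⟨P, Fr, hPF⟩, hbfn⟩ := hm
  exact ⟨_, _, ⟨rationalFunctionMonoidStr hF hsq hiso hPF.isBaseSection hbfn⟩⟩



/-- **[FrdI] Theorem 5.2 (iv), NON-VACUOUSLY**: every Frobenioid of isotropic and model type is
equivalent, compatibly with the structure functors, to the model Frobenioid of `(Φ, B, Div_B)` for SOME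
rational function monoid `B` carrying the structure of Thm. 5.2 (iv) — abc-iut-L6-t8's `thm52iv_holds`
(the ∀-statement over `RationalFunctionMonoidStr`) instantiated at the witness of
`rationalFunctionMonoid_exists`. [cite: MochizukiFrdI2008, Thm. 5.2 (iv) p.101] -/
theorem thm52iv_nonvacuous (hF : IsFrobenioid F) (hsq : HasBiratSquares F)
    (hiso : IsOfIsotropicType F) (hm : IsOfModelType F hF hsq) :
    ∃ (B : Dᵒᵖ ⥤ CommMonCat.{u'}) (DivB : B ⟶ monoidGp Φ) (_ : RationalFunctionMonoidStr F hF B DivB)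
      (E : C ⥤ ModelFrobenioid Φ B DivB),
      E.IsEquivalence ∧ OneCommutes E (ModelFrobenioid.toElem Φ B DivB) F (𝟭 (ElemFrobenioid Φ)) := by
  obtain ⟨B, DivB, ⟨R⟩⟩ := rationalFunctionMonoid_exists hF hsq hiso hm
  obtain ⟨E, hE, hc⟩ := thm52iv_holds hF hsq ⟨hm, hiso⟩ B DivB R
  exact ⟨B, DivB, R, E, hE, hc⟩

/-- The same with the canonical composition squares of a Frobenioid (`hasBiratSquares_of_isFrobenioid`).
[cite: MochizukiFrdI2008, Thm. 5.2 (iv) p.101] -/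
theorem thm52iv_nonvacuous' (hF : IsFrobenioid F) (hiso : IsOfIsotropicType F)
    (hm : IsOfModelType F hF (hasBiratSquares_of_isFrobenioid hF)) :
    ∃ (B : Dᵒᵖ ⥤ CommMonCat.{u'}) (DivB : B ⟶ monoidGp Φ) (_ : RationalFunctionMonoidStr F hF B DivB)
      (E : C ⥤ ModelFrobenioid Φ B DivB),
      E.IsEquivalence ∧ OneCommutes E (ModelFrobenioid.toElem Φ B DivB) F (𝟭 (ElemFrobenioid Φ)) :=
  thm52iv_nonvacuous hF _ hiso hm

end PreFrobenioid

end Literature.AlgebraicGeometry.Frobenioids
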